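import Literature.NumberTheory.LFunctions.NymanBeurling
import Literature.Analysis.SpecialFunctions.GammaVerticalRatio
import HarnessLib

/-!
# Báez-Duarte's Lemma 2.2: `|ζ(1/2-ε+iτ)/ζ(1/2+ε+iτ)| ≤ C (1+|τ|)^ε` — discharge

Topic: `Literature/NumberTheory/LFunctions`. Proof of the named fact
`Literature.NumberTheory.LFunctions.baezDuarte_zetaRatio_bound` (`Literature/NumberTheory/LFunctions/NymanBeurling.lean`;
Báez-Duarte 2003, Lemma 2.2, there deduced from the functional equation and Stirling's formula in
the form of Rademacher (21.51)–(21.52)). Here: the functional equation in the symmetric form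
`Λ(1-s) = Λ(s)` (Mathlib `completedRiemannZeta_one_sub`) with `ζ = Λ/Γ_ℝ`,
`Γ_ℝ(s) = π^{-s/2}Γ(s/2)`, and `ζ(s̄) = conj ζ(s)` give, for `s = 1/2-ε+iτ`,
`|ζ(s)| |Γ_ℝ(s)| = |ζ(1/2+ε+iτ)| |Γ_ℝ(1-s)|`, and
`|Γ_ℝ(1-s)|/|Γ_ℝ(s)| = π^{-ε} |Γ(1/4+ε/2+iτ/2)|/|Γ(1/4-ε/2+iτ/2)| ≤ K (1+|τ|)^ε` by the
elementary vertical ratio bound `Literature.Analysis.SpecialFunctions.GammaRatio.exists_norm_Gamma_shift_le`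
(`Literature/Analysis/SpecialFunctions/GammaVerticalRatio.lean`, with `x₀ = 1/8`).

## Main results (all proved)

* `Literature.NumberTheory.LFunctions.norm_Gammaℝ_one_sub_le` — `‖Γ_ℝ(1-s)‖ ≤ K(1+|τ|)^ε ‖Γ_ℝ(s)‖` for `s = 1/2-ε+iτ`,
  `0 ≤ ε ≤ ε₀ < 1/4`.
* `Literature.NumberTheory.LFunctions.baezDuarte_zetaRatio_bound_holds` — discharge of Lemma 2.2.

## References

* L. Báez-Duarte, *A strengthening of the Nyman–Beurling criterion for the Riemann hypothesis*,
  Atti Accad. Naz. Lincei Rend. Lincei (9) Mat. Appl. 14 (2003), 5–11, Lemma 2.2.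
* E. C. Titchmarsh, *The Theory of the Riemann Zeta-Function*, 2nd ed. (1986), §2.6 and (4.12.3).
-/

noncomputable section

open Complex Filter Topology Set

namespace Literature.NumberTheory.LFunctions

/-- `‖Γ_ℝ(w)‖ = π^{-re w/2} ‖Γ(w/2)‖`. [folklore] -/
lemma norm_Gammaℝ_eq (w : ℂ) : ‖Gammaℝ w‖ = Real.pi ^ (-w.re / 2) * ‖Complex.Gamma (w / 2)‖ := by
  rw [Gammaℝ_def, norm_mul, Complex.norm_cpow_eq_rpow_re_of_pos Real.pi_pos]
  congr 2
  simp [neg_div]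

/-- **The Gamma-factor ratio.** For `0 ≤ ε ≤ ε₀ < 1/4` there is `K = K(ε₀) > 0` (in fact
independent of `ε₀`) with `‖Γ_ℝ(1-s)‖ ≤ K (1+|τ|)^ε ‖Γ_ℝ(s)‖` for `s = 1/2 - ε + iτ`: by
`|Γ(z̄)| = |Γ(z)|` this is `π^{-ε}|Γ(1/4+ε/2+iτ/2)| ≤ K(1+|τ|)^ε |Γ(1/4-ε/2+iτ/2)|`, an instance
of `Literature.Analysis.SpecialFunctions.GammaRatio.exists_norm_Gamma_shift_le` (`x₀ = 1/8`, `x = 1/4-ε/2`, `δ = ε`, `u = τ/2`).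
[cite: BaezDuarte2003, Lemma 2.2 (proof)] -/
theorem norm_Gammaℝ_one_sub_le :
    ∃ K : ℝ, 0 < K ∧ ∀ ε τ : ℝ, 0 ≤ ε → ε < 1 / 4 →
      ‖Gammaℝ (1 - (1 / 2 - ε + τ * I))‖ ≤ K * (1 + |τ|) ^ ε * ‖Gammaℝ (1 / 2 - ε + τ * I)‖ := by
  obtain ⟨K, hK, hKb⟩ := Literature.Analysis.SpecialFunctions.GammaRatio.exists_norm_Gamma_shift_le (x₀ := 1 / 8) (by norm_num)
  refine ⟨K, hK, fun ε τ hε hε4 ↦ ?_⟩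
  have hb := hKb (1 / 4 - ε / 2) ε (τ / 2) (by linarith) (by linarith) hε (by linarith)
  -- identify the arguments
  have h1 : (1 - (1 / 2 - ε + τ * I) : ℂ) / 2 =
      (starRingEnd ℂ) ((((1 / 4 - ε / 2 + ε : ℝ) : ℂ)) + ((τ / 2 : ℝ) : ℂ) * I) := by
    rw [map_add, map_mul, Complex.conj_ofReal, Complex.conj_ofReal, Complex.conj_I]
    apply Complex.ext
    · simp; ring
    · simp; ring
  have h2 : (1 / 2 - ε + τ * I : ℂ) / 2 = ((1 / 4 - ε / 2 : ℝ) : ℂ) + ((τ / 2 : ℝ) : ℂ) * I := by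
    apply Complex.ext
    · simp; ring
    · simp
  rw [norm_Gammaℝ_eq, norm_Gammaℝ_eq, h1, h2, Complex.Gamma_conj, Complex.norm_conj]
  have hre1 : (1 - (1 / 2 - ε + τ * I) : ℂ).re = 1 / 2 + ε := by simp; ring
  have hre2 : (1 / 2 - ε + τ * I : ℂ).re = 1 / 2 - ε := by simp
  rw [hre1, hre2]
  have hπ := Real.pi_pos
  have hπ1 : (1 : ℝ) ≤ Real.pi := by linarith [Real.pi_gt_three]
  -- `π^{-(1/2+ε)/2} ≤ π^{-(1/2-ε)/2}` and `(1+|τ/2|)^ε ≤ (1+|τ|)^ε`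
  have hp : Real.pi ^ (-(1 / 2 + ε) / 2) ≤ Real.pi ^ (-(1 / 2 - ε) / 2) :=
    Real.rpow_le_rpow_of_exponent_le hπ1 (by linarith)
  have hτ : (1 + |τ / 2|) ^ ε ≤ (1 + |τ|) ^ ε := by
    refine Real.rpow_le_rpow (by positivity) ?_ hε
    rw [abs_div, abs_two]
    linarith [abs_nonneg τ]
  have hG : 0 ≤ ‖Complex.Gamma (((1 / 4 - ε / 2 : ℝ) : ℂ) + ((τ / 2 : ℝ) : ℂ) * I)‖ := norm_nonneg _
  have hp0 : 0 ≤ Real.pi ^ (-(1 / 2 + ε) / 2) := Real.rpow_nonneg hπ.le _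
  calc Real.pi ^ (-(1 / 2 + ε) / 2) *
        ‖Complex.Gamma (((1 / 4 - ε / 2 + ε : ℝ) : ℂ) + ((τ / 2 : ℝ) : ℂ) * I)‖
      ≤ Real.pi ^ (-(1 / 2 - ε) / 2) * (K * (1 + |τ|) ^ ε *
          ‖Complex.Gamma (((1 / 4 - ε / 2 : ℝ) : ℂ) + ((τ / 2 : ℝ) : ℂ) * I)‖) := by
        refine mul_le_mul hp (hb.trans ?_) (norm_nonneg _) (Real.rpow_nonneg hπ.le _)
        gcongr
    _ = K * (1 + |τ|) ^ ε * (Real.pi ^ (-(1 / 2 - ε) / 2) *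
          ‖Complex.Gamma (((1 / 4 - ε / 2 : ℝ) : ℂ) + ((τ / 2 : ℝ) : ℂ) * I)‖) := by ring

/-- **Discharge of Báez-Duarte's Lemma 2.2** (`Literature.NumberTheory.LFunctions.baezDuarte_zetaRatio_bound`): for
`0 ≤ ε ≤ ε₀ < 1/4`, `|ζ(1/2-ε+iτ)/ζ(1/2+ε+iτ)| ≤ C (1+|τ|)^ε` for all real `τ`. Proof: with
`s = 1/2-ε+iτ`, `s' = 1/2+ε+iτ = conj(1-s)`, `ζ(s)Γ_ℝ(s) = Λ(s) = Λ(1-s) = ζ(1-s)Γ_ℝ(1-s)` and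
`|ζ(1-s)| = |ζ(s')|` give `|ζ(s)| ≤ (|Γ_ℝ(1-s)|/|Γ_ℝ(s)|)|ζ(s')| ≤ K(1+|τ|)^ε|ζ(s')|`
(`norm_Gammaℝ_one_sub_le`). [cite: BaezDuarte2003, Lemma 2.2] -/
theorem baezDuarte_zetaRatio_bound_holds : baezDuarte_zetaRatio_bound := by
  intro ε₀ hε₀ hε₀4
  obtain ⟨K, hK, hKb⟩ := norm_Gammaℝ_one_sub_le
  refine ⟨K, hK, fun ε τ hε hεε₀ ↦ ?_⟩
  have hε4 : ε < 1 / 4 := lt_of_le_of_lt hεε₀ hε₀4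
  set s : ℂ := 1 / 2 - ε + τ * I with hs
  set s' : ℂ := 1 / 2 + ε + τ * I with hs'
  have hsre : s.re = 1 / 2 - ε := by simp [hs]
  have hs0 : s ≠ 0 := by
    intro h; have := congrArg Complex.re h; rw [hsre] at this; simp at this; linarith
  have h1s0 : 1 - s ≠ 0 := by
    intro h; have := congrArg Complex.re h; simp [hs] at this; linarith
  have hΓs : Gammaℝ s ≠ 0 := Gammaℝ_ne_zero_of_re_pos (by rw [hsre]; linarith)
  have hΓ1s : Gammaℝ (1 - s) ≠ 0 := Gammaℝ_ne_zero_of_re_pos (by simp [hs]; linarith)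
  -- `ζ(s) Γℝ(s) = Λ(s) = ζ(1-s) Γℝ(1-s)`
  have hζs : riemannZeta s * Gammaℝ s = completedRiemannZeta s := by
    rw [riemannZeta_def_of_ne_zero hs0, div_mul_cancel₀ _ hΓs]
  have hζ1s : riemannZeta (1 - s) * Gammaℝ (1 - s) = completedRiemannZeta s := by
    rw [riemannZeta_def_of_ne_zero h1s0, div_mul_cancel₀ _ hΓ1s, completedRiemannZeta_one_sub]
  -- `‖ζ(1-s)‖ = ‖ζ(s')‖`
  have hconj : 1 - s = (starRingEnd ℂ) s' := by
    apply Complex.ext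
    · simp [hs, hs']; ring
    · simp [hs, hs']
  have hnorm1s : ‖riemannZeta (1 - s)‖ = ‖riemannZeta s'‖ := by
    rw [hconj, riemannZeta_conj, Complex.norm_conj]
  -- the Gamma-factor ratio
  have hG := hKb ε τ hε hε4
  have hΓs_pos : 0 < ‖Gammaℝ s‖ := norm_pos_iff.2 hΓs
  have hkey : ‖riemannZeta s‖ ≤ K * (1 + |τ|) ^ ε * ‖riemannZeta s'‖ := by
    have e1 : ‖riemannZeta s‖ * ‖Gammaℝ s‖ = ‖riemannZeta s'‖ * ‖Gammaℝ (1 - s)‖ := by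
      calc ‖riemannZeta s‖ * ‖Gammaℝ s‖ = ‖completedRiemannZeta s‖ := by rw [← norm_mul, hζs]
        _ = ‖riemannZeta (1 - s)‖ * ‖Gammaℝ (1 - s)‖ := by rw [← hζ1s, norm_mul]
        _ = ‖riemannZeta s'‖ * ‖Gammaℝ (1 - s)‖ := by rw [hnorm1s]
    have e2 : ‖riemannZeta s'‖ * ‖Gammaℝ (1 - s)‖ ≤
        ‖riemannZeta s'‖ * (K * (1 + |τ|) ^ ε * ‖Gammaℝ s‖) :=
      mul_le_mul_of_nonneg_left hG (norm_nonneg _)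
    have e3 : ‖riemannZeta s‖ * ‖Gammaℝ s‖ ≤ (K * (1 + |τ|) ^ ε * ‖riemannZeta s'‖) * ‖Gammaℝ s‖ := by
      rw [e1]; linarith
    exact le_of_mul_le_mul_right e3 hΓs_pos
  have hC0 : 0 ≤ K * (1 + |τ|) ^ ε := by positivity
  by_cases hz : riemannZeta s' = 0
  · rw [hz, div_zero, norm_zero]; exact hC0
  · rw [norm_div, div_le_iff₀ (norm_pos_iff.2 hz)]
    exact hkey

end Literature.NumberTheory.LFunctions

end
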